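import Summits.CriticalPhenomena.SAWScalingLimit.Theorems.CriticalBubbleBound.Negative.CriticalBubbleBoundPolygonSeries

/-!
# Negative-side results for the crux `SAWTotalPositivity.CriticalBubbleBound` (stmt-CriticalPhenomena-7117):
the polygon mass function has radius EXACTLY `x_c`; the crux is its value AT the radius (work-file §22)

`polygonSeriesAt x = T_x := Σ_N N q_N x^N`: the fugacity-free combinatorics of work-file §18 give
`ofReal_mul_sum_latticeKernel : x · Σ_{e∼0} K_x(0,e) = 4x² + 2 T_x` for all `x ≥ 0`, hence
`criticalBubbleBoundAt_iff_polygonSeriesAt_ne_top : CriticalBubbleBoundAt x ↔ T_x < ∞` (`x > 0`),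
`polygonSeriesAt_ne_top_of_lt` (`T_x < ∞` on `(0, x_c)`, subcritical side) and
`polygonSeriesAt_eq_top_of_criticalFugacity_lt` (`T_x = ∞` on `(x_c, ∞)`, from the supercritical
side / Duminil-Copin–Kozma–Yadin Prop. 3, i.e. `limsup q_N^{1/N} ≥ μ` without bridges). Summary
`polygonSeries_radius`: the crux is exactly "the nonnegative power series `T_x` is finite AT its
radius of convergence `x_c`" — the sign of `θ - 2`.

Refuter `cdisprove` (standing adversary, gen 4); the full indexed work file is
`Summits/CriticalPhenomena/SAWScalingLimit/Cruxes/CriticalBubbleBound/Disproof.lean` (§22).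
-/

noncomputable section

open MeasureTheory Filter Topology Set Function
open Literature.Probability.LatticeModels
open Literature.Probability.RandomPlanarGeometry Literature.Probability.RandomPlanarGeometry.SAW
open scoped ENNReal NNReal BigOperators

namespace Summit.CriticalPhenomena.SAWScalingLimit.Theorems.CriticalBubbleBound.Negative

open Summit.CriticalPhenomena.SAWScalingLimit.Theses.SAWTotalPositivity (CriticalBubbleBound)
open Literature.Barriers.CriticalPhenomena (isotropicPolygonCount)

/-! ## §22 The polygon mass function `T_x := Σ_N N q_N x^N` has radius of convergence EXACTLY `x_c`;
the crux is its finiteness AT the radius -/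

/-- `T_x := Σ_N N q_N x^N ∈ [0,∞]`, the vertex-rooted polygon mass at fugacity `x`
(`T_{x_c} = T` of §18). [cite: MadrasSlade1993, §3.2, eq. (3.2.1)] -/
def polygonSeriesAt (x : ℝ) : ℝ≥0∞ :=
  ∑' N : ℕ, ((N * isotropicPolygonCount N : ℕ) : ℝ≥0∞) * ENNReal.ofReal (x ^ N)

/-- At `x_c` this is the series of §18. [folklore] -/
theorem polygonSeriesAt_criticalFugacity : polygonSeriesAt criticalFugacity = polygonSeries := rfl

/-- The four nearest-neighbour kernels as one length series, any fugacity. [folklore] -/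
theorem sum_latticeKernel_eq_tsum (x : ℝ) :
    ∑ e ∈ (zdGraph 2).neighborFinset 0, latticeKernel x 0 e =
      ∑' n : ℕ, ((∑ e ∈ (zdGraph 2).neighborFinset 0, Zd.countAt 2 n e : ℕ) : ℝ≥0∞) *
        ENNReal.ofReal (x ^ n) := by
  simp_rw [latticeKernel_zero_eq_tsum_countAt]
  rw [← Summable.tsum_finsetSum (fun _ _ => ENNReal.summable)]
  refine tsum_congr fun n => ?_
  rw [Nat.cast_sum, Finset.sum_mul]

/-- **THE LOOP/POLYGON IDENTITY AT EVERY FUGACITY `x ≥ 0`**: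
`x · Σ_{e ∼ 0} K_x(0,e) = 4x² + 2 T_x` (the combinatorics `Σ_{e∼0} c_{N-1}(0,e) = 2N q_N` is
fugacity-free). [cite: MadrasSlade1993, §3.2, eq. (3.2.1)] -/
theorem ofReal_mul_sum_latticeKernel {x : ℝ} (hx0 : 0 ≤ x) :
    ENNReal.ofReal x * ∑ e ∈ (zdGraph 2).neighborFinset 0, latticeKernel x 0 e =
      4 * ENNReal.ofReal (x ^ 2) + 2 * polygonSeriesAt x := by
  set X : ℕ → ℝ≥0∞ := fun n => ENNReal.ofReal (x ^ n) with hX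
  have hXmul : ∀ n, ENNReal.ofReal x * X n = X (n + 1) := fun n => by
    simp only [hX]
    rw [← ENNReal.ofReal_mul hx0, pow_succ, mul_comm]
  set a : ℕ → ℕ := fun n => ∑ e ∈ (zdGraph 2).neighborFinset 0, Zd.countAt 2 n e with ha
  have hS : ∑ e ∈ (zdGraph 2).neighborFinset 0, latticeKernel x 0 e = ∑' n, (a n : ℝ≥0∞) * X n :=
    sum_latticeKernel_eq_tsum x
  have hS2 : ∑' n, (a n : ℝ≥0∞) * X n = 4 * X 1 + ∑' K, (a (2 * K + 3) : ℝ≥0∞) * X (2 * K + 3) := by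
    rw [← tsum_even_add_odd (f := fun n => (a n : ℝ≥0∞) * X n) ENNReal.summable ENNReal.summable]
    have heven : ∀ K, (a (2 * K) : ℝ≥0∞) * X (2 * K) = 0 := fun K => by
      rw [show a (2 * K) = 0 from loopCount_even K]
      simp
    simp only [heven, tsum_zero, zero_add]
    rw [tsum_eq_zero_add' ENNReal.summable]
    congr 1
    rw [show a (2 * 0 + 1) = 4 from sum_countAt_one]
    simp
  have hP : polygonSeriesAt x =
      ∑' K, (((2 * K + 4) * isotropicPolygonCount (2 * K + 4) : ℕ) : ℝ≥0∞) * X (2 * K + 4) := by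
    rw [polygonSeriesAt]
    change ∑' N, ((N * isotropicPolygonCount N : ℕ) : ℝ≥0∞) * X N = _
    rw [← tsum_even_add_odd (f := fun N => ((N * isotropicPolygonCount N : ℕ) : ℝ≥0∞) * X N)
      ENNReal.summable ENNReal.summable]
    have hodd : ∀ K, (((2 * K + 1) * isotropicPolygonCount (2 * K + 1) : ℕ) : ℝ≥0∞) * X (2 * K + 1) = 0 :=
      fun K => by rw [isotropicPolygonCount_odd]; simp
    simp only [hodd, tsum_zero, add_zero]
    rw [tsum_eq_zero_add' ENNReal.summable, tsum_eq_zero_add' ENNReal.summable]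
    have h0 : (((2 * 0) * isotropicPolygonCount (2 * 0) : ℕ) : ℝ≥0∞) * X (2 * 0) = 0 := by simp
    have h1 : (((2 * (0 + 1)) * isotropicPolygonCount (2 * (0 + 1)) : ℕ) : ℝ≥0∞) * X (2 * (0 + 1)) = 0 := by
      rw [show 2 * (0 + 1) = 2 by rfl, isotropicPolygonCount_two]
      simp
    rw [h0, h1, zero_add, zero_add]
    refine tsum_congr fun K => ?_
    rw [show 2 * (K + 1 + 1) = 2 * K + 4 by ring]
  rw [hS, hS2, mul_add, ← ENNReal.tsum_mul_left, hP, ← ENNReal.tsum_mul_left]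
  congr 1
  · rw [← mul_assoc, mul_comm (ENNReal.ofReal x) 4, mul_assoc, hXmul 1]
  · refine tsum_congr fun K => ?_
    rw [← mul_assoc, mul_comm (ENNReal.ofReal x), mul_assoc, hXmul,
      show a (2 * K + 3) = 2 * (2 * K + 4) * isotropicPolygonCount (2 * K + 4) from loopCount_odd K,
      show 2 * K + 3 + 1 = 2 * K + 4 by ring]
    push_cast
    ring

/-- `CriticalBubbleBoundAt x` in one-number form: all four `K_x(0,e)`, `e ∼ 0`, finite. [folklore] -/
theorem criticalBubbleBoundAt_iff_forall (x : ℝ) :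
    CriticalBubbleBoundAt x ↔ ∀ e : Site 2, (zdGraph 2).Adj 0 e → latticeKernel x 0 e ≠ ⊤ := by
  rw [criticalBubbleBoundAt_iff_latticeKernel]
  constructor
  · rintro ⟨C, hC, h⟩ e he
    exact ne_top_of_le_ne_top hC (h 0 e he)
  · intro h
    refine ⟨∑ e ∈ (zdGraph 2).neighborFinset 0, latticeKernel x 0 e, ?_, fun u v huv => ?_⟩
    · exact ENNReal.sum_ne_top.2 fun e he => h e ((SimpleGraph.mem_neighborFinset _ _ _).1 he)
    · rw [latticeKernel_eq_zero_sub]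
      have hadj : (zdGraph 2).Adj 0 (v - u) := by
        have := (Zd.zdGraph_adj_sub_right u v u).2 huv
        rwa [sub_self] at this
      exact Finset.single_le_sum (f := fun e => latticeKernel x 0 e) (fun _ _ => zero_le)
        ((SimpleGraph.mem_neighborFinset _ _ _).2 hadj)

/-- **`CriticalBubbleBoundAt x ⟺ T_x < ∞`** for every `x > 0`. [cite: MadrasSlade1993, §3.2, eq. (3.2.1)] -/
theorem criticalBubbleBoundAt_iff_polygonSeriesAt_ne_top {x : ℝ} (hx : 0 < x) :
    CriticalBubbleBoundAt x ↔ polygonSeriesAt x ≠ ⊤ := by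
  rw [criticalBubbleBoundAt_iff_forall]
  have hid := ofReal_mul_sum_latticeKernel hx.le
  have hx0 : ENNReal.ofReal x ≠ 0 := (ENNReal.ofReal_pos.2 hx).ne'
  constructor
  · intro h hP
    have hS : ∑ e ∈ (zdGraph 2).neighborFinset 0, latticeKernel x 0 e ≠ ⊤ :=
      ENNReal.sum_ne_top.2 fun e he => h e ((SimpleGraph.mem_neighborFinset _ _ _).1 he)
    have hfin : ENNReal.ofReal x * ∑ e ∈ (zdGraph 2).neighborFinset 0, latticeKernel x 0 e ≠ ⊤ :=
      ENNReal.mul_ne_top ENNReal.ofReal_ne_top hS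
    rw [hid, hP, ENNReal.mul_top two_ne_zero] at hfin
    exact hfin (by simp)
  · intro hP e he
    have hfin : 4 * ENNReal.ofReal (x ^ 2) + 2 * polygonSeriesAt x ≠ ⊤ :=
      ENNReal.add_ne_top.2 ⟨ENNReal.mul_ne_top (by simp) ENNReal.ofReal_ne_top,
        ENNReal.mul_ne_top (by simp) hP⟩
    rw [← hid] at hfin
    have hS : ∑ e ∈ (zdGraph 2).neighborFinset 0, latticeKernel x 0 e ≠ ⊤ := by
      intro htop
      rw [htop, ENNReal.mul_top hx0] at hfin
      exact hfin rfl
    exact ne_top_of_le_ne_top hS (Finset.single_le_sum (f := fun e => latticeKernel x 0 e)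
      (fun _ _ => zero_le) ((SimpleGraph.mem_neighborFinset _ _ _).2 he))

/-- **`T_x = ∞` for every `x > x_c`** — the polygon generating function diverges above the
critical fugacity (`limsup q_N^{1/N} ≥ μ`, the non-trivial half of Madras–Slade Corollary 3.2.5),
obtained here from the SUPERCRITICAL side §4 (Duminil-Copin–Kozma–Yadin Prop. 3) instead of
Kesten's bridges. [cite: MadrasSlade1993, Corollary 3.2.5] -/
theorem polygonSeriesAt_eq_top_of_criticalFugacity_lt {x : ℝ} (hx : criticalFugacity < x) :
    polygonSeriesAt x = ⊤ := by
  by_contra h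
  exact not_criticalBubbleBoundAt_of_criticalFugacity_lt hx
    ((criticalBubbleBoundAt_iff_polygonSeriesAt_ne_top (criticalFugacity_pos_lt_one'.1.trans hx)).2 h)

/-- **`T_x < ∞` for every `0 < x < x_c`** (from the SUBCRITICAL side §5). [cite: BDGS2012, §1.5.3] -/
theorem polygonSeriesAt_ne_top_of_lt {x : ℝ} (hx0 : 0 < x) (hx : x < criticalFugacity) :
    polygonSeriesAt x ≠ ⊤ :=
  (criticalBubbleBoundAt_iff_polygonSeriesAt_ne_top hx0).1 (criticalBubbleBoundAt_of_lt hx0 hx)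

/-- **WHERE THE CRUX SITS**: the polygon mass function `x ↦ T_x = Σ_N N q_N x^N` is finite on
`(0, x_c)` and infinite on `(x_c, ∞)` — its radius of convergence is exactly `x_c` — and
`CriticalBubbleBound` is precisely the statement that it is finite AT the radius (a power series
with nonnegative coefficients evaluated on its circle of convergence: no soft argument decides
this; it is the sign of `θ - 2`). [cite: MadrasSlade1993, §1.4 and Corollary 3.2.5] -/
theorem polygonSeries_radius :
    (∀ x : ℝ, 0 < x → x < criticalFugacity → polygonSeriesAt x ≠ ⊤) ∧
      (∀ x : ℝ, criticalFugacity < x → polygonSeriesAt x = ⊤) ∧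
      (CriticalBubbleBound ↔ polygonSeriesAt criticalFugacity ≠ ⊤) :=
  ⟨fun _ hx0 hx => polygonSeriesAt_ne_top_of_lt hx0 hx,
    fun _ hx => polygonSeriesAt_eq_top_of_criticalFugacity_lt hx,
    criticalBubbleBound_iff_polygonSeries_ne_top⟩

end Summit.CriticalPhenomena.SAWScalingLimit.Theorems.CriticalBubbleBound.Negative
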